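import Mathlib

/-!
Sketch for crux-ideate stmt-Parity-11583 (SplitBlockJacobi), ideator 1, round 1.
First-lemma signatures of the two idea cards; they only need to ELABORATE.
-/

namespace Summit.Parity.BatemanHorn.Cruxes.SplitBlockJacobi.Sketch

open scoped BigOperators

/-- Card `prime-pair-crt-corner`, first lemma (the corner of the crux):
there is δ > 0 such that for every θ ∈ (1/2,1) the split-block sum restricted to prime pairs
with `Q·Q' ≤ x^{1+δ}` is `o(x)`.  Same vocabulary as the crux decl. -/
def CornerSplitBlock : Prop :=
  ∃ δ : ℝ, 0 < δ ∧ ∀ θ : ℝ, 1 / 2 < θ → θ < 1 →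
    (fun x : ℕ => ∑ t ∈ Finset.Icc 1 x,
      ∑ q ∈ ((t ^ 2 + 1).primeFactors ×ˢ (t ^ 2 + 1).primeFactors).filter
        (fun q : ℕ × ℕ => (x : ℝ) ^ θ < (q.1 : ℝ) ∧ q.1 < q.2 ∧ ((q.1 * q.2 : ℕ) : ℝ) ≤ (x : ℝ) ^ (1 + δ)),
        (jacobiSym (q.1 : ℤ) q.2 : ℝ)) =o[Filter.atTop] fun x : ℕ => (x : ℝ)

/-- Card `prime-pair-crt-corner`, load-bearing stub (mixed Jacobi × Kloosterman-fraction bilinear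
bound): a power saving, uniform in `0 < |h| ≤ (P₁P₂)^{δ₀}`, in
`T_h = Σ_{Q,Q'} (Q|Q') Σ_{r,r'} e(h (r·Q'⁻¹/Q + r'·Q⁻¹/Q'))` over primes `Q ≡ Q' ≡ 1 (4)` in dyadic
ranges, `r, r'` the roots of `-1`.  (`h = 0` is Heath-Brown's quadratic large sieve / FI Prop. 21.3.) -/
def MixedBilinear : Prop :=
  ∃ δ₀ : ℝ, 0 < δ₀ ∧ ∃ C : ℝ, ∀ P₁ P₂ : ℕ, 2 ≤ P₁ → P₁ ≤ P₂ → (P₂ : ℝ) ≤ (P₁ : ℝ) ^ (2 : ℝ) →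
    ∀ h : ℤ, h ≠ 0 → (|h| : ℝ) ≤ ((P₁ * P₂ : ℕ) : ℝ) ^ δ₀ →
      ‖∑ Q ∈ (Finset.Ioc P₁ (2 * P₁)).filter (fun Q : ℕ => Q.Prime ∧ Q % 4 = 1),
        ∑ Q' ∈ (Finset.Ioc P₂ (2 * P₂)).filter (fun Q' : ℕ => Q'.Prime ∧ Q' % 4 = 1 ∧ Q < Q'),
          (jacobiSym (Q : ℤ) Q' : ℂ) *
            ∑ r ∈ (Finset.range Q).filter (fun r : ℕ => Q ∣ r ^ 2 + 1),
              ∑ r' ∈ (Finset.range Q').filter (fun r' : ℕ => Q' ∣ r' ^ 2 + 1),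
                Complex.exp (2 * Real.pi * Complex.I * (h : ℂ) *
                  ((((r * ((Q' : ZMod Q)⁻¹).val : ℕ) : ℂ) / (Q : ℂ)) +
                   (((r' * ((Q : ZMod Q')⁻¹).val : ℕ) : ℂ) / (Q' : ℂ))))‖
        ≤ C * ((P₁ * P₂ : ℕ) : ℝ) ^ (1 - δ₀)

/-- Card `hensel-digit-core`, transfer statement C⁺ (primes-only core statistic): the Legendre
symbol modulo `Q` of the cofactor `(r²+1)/Q`, summed over the roots `r` of `-1 (mod Q)` and over
primes `Q ≡ 1 (4)` up to `X`, is `o(π(X))`; with the shift `j` this is the `t = r + jQ` slice. -/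
def CoreHenselLegendre : Prop :=
  ∀ j : ℕ, (fun X : ℕ => ∑ Q ∈ (Finset.range (X + 1)).filter (fun Q : ℕ => Q.Prime ∧ Q % 4 = 1),
      ∑ r ∈ (Finset.range Q).filter (fun r : ℕ => Q ∣ r ^ 2 + 1),
        (jacobiSym ((((r + j * Q) ^ 2 + 1) / Q : ℕ) : ℤ) Q : ℝ))
    =o[Filter.atTop] fun X : ℕ => (X : ℝ) / Real.log X

/-- Card `hensel-digit-core`, first rung (second-digit equidistribution of √-1 modulo prime
squares, Weyl form): for every fixed nonzero `h`, the Weyl sums of the roots of `X²+1` modulo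
`Q²` over primes `Q ≤ X` are `o(π(X))`. -/
def PrimeSquareRoots : Prop :=
  ∀ h : ℤ, h ≠ 0 → (fun X : ℕ => ∑ Q ∈ (Finset.range (X + 1)).filter (fun Q : ℕ => Q.Prime ∧ Q % 4 = 1),
      ∑ ν ∈ (Finset.range (Q ^ 2)).filter (fun ν : ℕ => Q ^ 2 ∣ ν ^ 2 + 1),
        Complex.exp (2 * Real.pi * Complex.I * (h : ℂ) * ((ν : ℂ) / ((Q : ℂ) ^ 2))))
    =o[Filter.atTop] fun X : ℕ => ((X : ℝ) / Real.log X : ℝ)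

end Summit.Parity.BatemanHorn.Cruxes.SplitBlockJacobi.Sketch
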